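/-
Copyright (c) 2026 the pub-hodgecm-mathlib formalisation cell (harness21).  Prover seat hodgecm-mathlib-F0P2-p02 (g14): road «S3-ram» (LEAD F0P3a-plan (g13);
owner F0P3a-p06 (g15); (Cnt2′) chair F0P3a-p07 (g14) ruling (3), 2026-09-02T02:14:32Z), organ (z3) «CONE TRANSPORT», generic graph half (a); 2026-09-02.
-/
import Literature.NumberTheory.Rogawski1990.DepthZeroKappaTransferTypeOneRamifiedRootRegionInduction   -- ★ ENGINE ED. 3 (F0P3a-p02 (g17)): `strataVec_cone_eq_of_localLaw_offRegion`, `grandchild_mem_and_sd_and_dist`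
import Literature.Combinatorics.SimpleGraph.TreeRetractionConeShadow                                   -- ★ (z3)(b) (this seat): `cone_eq_setOf_dist_root_of_mem_cone` (cone toward a subtree = rooted shadow from the gate)
import HarnessLib

/-!
# The ramified type-(1) `κ`-orbital integral: the tree induction LOCALISED TO ONE CONE — the strata vector of a cone from the local branching law inside that cone only;
# rooted form and the form TOWARD A SUBTREE (Kottwitz 1986 §3; Rogawski 1990 §4.9; Serre, *Trees* I.2.3)

Topic `NumberTheory/Rogawski1990`; namespace `Literature.NumberTheory.Rogawski1990`.  THEOREMS ONLY (no definition, no instance, no notation, no named fact, no `sorry`);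
kernel lane `--supports stmt-HodgeConjecture-24833`; imports ★ `DepthZeroKappaTransferTypeOneRamifiedRootRegionInduction` (ENGINE ED. 3, F0P3a-p02 (g17)) and ★
`TreeRetractionConeShadow` — a GENERIC rooted-tree statement (any `SimpleGraph`, any vertex type), no lattice ∕ CM token.  Cell `pub/hodgecm-mathlib` (D-0151), crux H413;
road «S3-ram» (Literature seeding, count-neutral), the (Cnt2′) type-(2) G-side assembly of chair F0P3a-p07 (g14): organ **(z3) «CONE TRANSPORT», generic graph half (a)**
(ruling (3), 2026-09-02T02:14:32Z).

WHY THIS FILE.  In the type-(2) tube (DESIGN-A2d v1.2 ∕ v1.3, HIST (L6)) the fixed labelled subtree of a literal `ι(γ_W, u)` obeys the GENERIC local branching law of the ★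
engine (`hB hC hR hE hO hP`) at every fixed self-dual vertex OFF the axis and its collar, but NOT on the axis; the counts are assembled axis vertex by axis vertex, and under
each one COLLAR CHILD by collar child — so one needs the ★ induction with the law assumed ONLY INSIDE THE CONE of one vertex `c` (a collar child), concluding for every fixed
self-dual vertex of that cone.  This is ★ ED. 3 §2 `strataVec_cone_eq_of_localLaw_offRegion` with the root region `R :=` the COMPLEMENT of the cone of `c` (an up-set:
a cone is down-closed, ★ `setOf_dist_subset_of_mem`); we file it by name (§1), and (§2) read it in the currency of cones TOWARD A SUBTREE `Y` (the axis), rooting the tree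
at the gate `y = p^[h c] c` of `c` (★ `cone_eq_setOf_dist_root_of_mem_cone`: below `c` the two cone currencies agree).

THE SETTING (verbatim the ★ engine's): tree `G`, root `r`, finite parent-closed `F`, alternating `SD`, labels `dep rk cl`, strata `str` (`hstr`), grandchildren binder
`GC` with `hGC` (rooted at `r`), residue cardinality `q`, class flip `s`, any solution `(TE, TO, TP)` of the shell recursion; a vertex `c` (any); the law hypotheses
`hrk hcl hodd hB hC hR hE hO hP` assumed for `v ∈ F`, `SD v`, `v` IN THE CONE OF `c` (`G.dist r v = G.dist r c + G.dist c v`) only.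
* §1 **`strataVec_cone_eq_of_localLaw_of_cone`** — for every fixed self-dual `v` in the cone of `c`: the strata vector of the cone of `v` is `T(label v)`.
* §2 **`strataVec_cone_eq_of_localLaw_of_cone_toward`** — the same for retraction data `(h, p)` toward a vertex set `Y` (★ `TreeRetraction.exists_retraction` clauses as
  hypotheses), `c ∉ Y` with gate `y = p^[h c] c`, the tree rooted at `y` (`F` parent-closed toward `y`, `GC` rooted at `y`), the law assumed on `F ∩ Cone_Y(c)` and the
  conclusion read on `Cone_Y(v) = {w | h v ≤ h w ∧ p^[h w − h v] w = v}` for every fixed self-dual `v ∈ Cone_Y(c)`.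
HONEST LABEL: HC_CM is proved only modulo the 2 remaining named inputs (hLiu418 24832, h413 24833) until rung 0 closes; nothing printed is asserted here (rooted-tree bookkeeping).

## References
* [Kottwitz1986] R. E. Kottwitz, *Base change for unit elements of Hecke algebras*, Compositio Math. 60 (1986), §3 (counting fixed lattices shell by shell).
* [Rogawski1990] J. D. Rogawski, *Automorphic Representations of Unitary Groups in Three Variables*, Ann. of Math. Stud. 123 (1990), §4.9 pp. 54–56.
* [Serre1980Trees] J.-P. Serre, *Trees* (1980), I.2.3 (cones, projection onto a subtree), II.1.1 (the tree of lattices).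
-/

set_option autoImplicit false

open Finset SimpleGraph
open Literature.Combinatorics.SimpleGraph.TreeLayers

namespace Literature.NumberTheory.Rogawski1990

variable {V : Type*} {G : SimpleGraph V}

/-! ## §1 The induction localised to the cone of one vertex (rooted form) -/

/-- **THE TREE INDUCTION LOCALISED TO ONE CONE.**  The ★ engine `strataVec_cone_eq_of_localLaw` with the local branching law (`hrk hcl hodd hB hC hR hE hO hP`) assumed
only at the fixed self-dual vertices of the CONE of a vertex `c` (`G.dist r v = G.dist r c + G.dist c v`): the strata vector of the cone of every fixed self-dual vertex `v`
of that cone is `T(label v)`.  (★ `strataVec_cone_eq_of_localLaw_offRegion` with the root region `R :=` the complement of the cone of `c`.)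
[cite: Kottwitz1986, §3] [cite: Rogawski1990, §4.9 pp. 54–56] [cite: Serre1980Trees, I.2.3] -/
theorem strataVec_cone_eq_of_localLaw_of_cone (hT : G.IsTree) (r : V) (F : Set V) (hFfin : F.Finite)
    (hF : ∀ w ∈ F, w ≠ r → ∀ u, G.Adj w u → G.dist r u + 1 = G.dist r w → u ∈ F) (SD : V → Prop) (str : Fin 5 → V → Prop)
    [DecidablePred (· ∈ F)] [DecidablePred SD] [∀ j, DecidablePred (str j)]
    (hSD₁ : ∀ v c, G.Adj v c → SD v → ¬ SD c) (hSD₂ : ∀ c w, G.Adj c w → ¬ SD c → SD w)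
    (dep rk : V → ℕ) (cl : V → ℤ)
    (hstr : ∀ w ∈ F, SD w → (str 0 w ↔ dep w = 0) ∧ (str 1 w ↔ dep w = 1 ∧ rk w = 2) ∧ (str 2 w ↔ dep w = 1 ∧ rk w = 1 ∧ cl w = 1) ∧
      (str 3 w ↔ dep w = 1 ∧ rk w = 1 ∧ cl w = -1) ∧ (str 4 w ↔ 2 ≤ dep w))
    (GC : V → Set V)
    (hGC : ∀ v w, w ∈ GC v ↔ ∃ c, (G.Adj v c ∧ G.dist r c = G.dist r v + 1 ∧ c ∈ F) ∧ (G.Adj c w ∧ G.dist r w = G.dist r c + 1 ∧ w ∈ F))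
    (q : ℕ) (s : ℤ) (c : V)
    (hrk : ∀ v ∈ F, SD v → G.dist r v = G.dist r c + G.dist c v → 1 ≤ dep v → rk v = 1 ∨ rk v = 2)
    (hcl : ∀ v ∈ F, SD v → G.dist r v = G.dist r c + G.dist c v → rk v = 1 → cl v = 1 ∨ cl v = -1)
    (hodd : ∀ v ∈ F, SD v → G.dist r v = G.dist r c + G.dist c v → 2 ≤ dep v → rk v = 1 → Odd (dep v))
    (hB : ∀ v ∈ F, SD v → G.dist r v = G.dist r c + G.dist c v → dep v = 0 → GC v = ∅)
    (hC : ∀ v ∈ F, SD v → G.dist r v = G.dist r c + G.dist c v → dep v = 1 → rk v = 1 → GC v = ∅)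
    (hR : ∀ v ∈ F, SD v → G.dist r v = G.dist r c + G.dist c v → dep v = 1 → rk v = 2 → (∀ w ∈ GC v, dep w = 0) ∧ (GC v).ncard = q)
    (hE : ∀ v ∈ F, SD v → G.dist r v = G.dist r c + G.dist c v → ∀ m, dep v = 2 * m + 2 → rk v = 2 →
      (∀ w ∈ GC v, dep w = 2 * m + 1 ∧ rk w = 2) ∧ (GC v).ncard = q ^ 2)
    (hO : ∀ v ∈ F, SD v → G.dist r v = G.dist r c + G.dist c v → ∀ m, dep v = 2 * m + 3 → rk v = 2 →
      (∀ w ∈ GC v, (dep w = 2 * m + 2 ∧ rk w = 2) ∨ (dep w = 2 * m + 1 ∧ rk w = 1 ∧ (cl w = 1 ∨ cl w = -1))) ∧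
        {w | w ∈ GC v ∧ dep w = 2 * m + 2}.ncard = q ∧ {w | w ∈ GC v ∧ dep w = 2 * m + 1 ∧ cl w = 1}.ncard = q.choose 2 ∧
          {w | w ∈ GC v ∧ dep w = 2 * m + 1 ∧ cl w = -1}.ncard = q.choose 2)
    (hP : ∀ v ∈ F, SD v → G.dist r v = G.dist r c + G.dist c v → ∀ m (c' : ℤ), dep v = 2 * m + 3 → rk v = 1 → cl v = c' →
      (∀ w ∈ GC v, dep w = 2 * m + 1 ∧ rk w = 1 ∧ cl w = s * c') ∧ (GC v).ncard = q ^ 2)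
    (TE TO : ℕ → Fin 5 → ℕ) (TP : ℤ → ℕ → Fin 5 → ℕ)
    (hTE : ∀ m, TE (m + 1) = ![0, 0, 0, 0, 1] + q ^ 2 • TO m)
    (hTO0 : TO 0 = ![0, 1, 0, 0, 0] + q • ![1, 0, 0, 0, 0])
    (hTOs : ∀ m, TO (m + 1) = ![0, 0, 0, 0, 1] + q • TE (m + 1) + q.choose 2 • (TP 1 m + TP (-1) m))
    (hTP0 : TP 1 0 = ![0, 0, 1, 0, 0]) (hTP0' : TP (-1) 0 = ![0, 0, 0, 1, 0])
    (hTPs : ∀ m (c' : ℤ), c' = 1 ∨ c' = -1 → TP c' (m + 1) = ![0, 0, 0, 0, 1] + q ^ 2 • TP (s * c') m)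
    {v : V} (hv : v ∈ F) (hvS : SD v) (hvc : G.dist r v = G.dist r c + G.dist c v) :
    (fun j => ({w | G.dist r w = G.dist r v + G.dist v w} ∩ F ∩ {w | SD w ∧ str j w}).ncard) =
      if dep v = 0 then ![1, 0, 0, 0, 0]
      else if rk v = 2 then (if Even (dep v) then TE (dep v / 2) else TO (dep v / 2)) else TP (cl v) (dep v / 2) := by
  -- the root region: the complement of the cone of `c` (an up-set of the fixed self-dual tree)
  have hRup : ∀ v ∈ F, SD v → ∀ w ∈ GC v, w ∈ {u | G.dist r u ≠ G.dist r c + G.dist c u} → v ∈ {u | G.dist r u ≠ G.dist r c + G.dist c u} := by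
    intro v _ hvS' w hw hwR hvc'
    obtain ⟨-, -, -, hdw⟩ := grandchild_mem_and_sd_and_dist hT r F SD hSD₁ hSD₂ GC hGC hvS' hw
    exact hwR (setOf_dist_subset_of_mem hT r hvc' hdw)
  have e : ∀ {u : V}, u ∉ {u | G.dist r u ≠ G.dist r c + G.dist c u} → G.dist r u = G.dist r c + G.dist c u := fun hu => not_ne_iff.1 hu
  exact strataVec_cone_eq_of_localLaw_offRegion hT r F hFfin hF SD str hSD₁ hSD₂ dep rk cl hstr GC hGC q s
    {u | G.dist r u ≠ G.dist r c + G.dist c u} hRup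
    (fun v hv hS hRR => hrk v hv hS (e hRR)) (fun v hv hS hRR => hcl v hv hS (e hRR)) (fun v hv hS hRR => hodd v hv hS (e hRR))
    (fun v hv hS hRR => hB v hv hS (e hRR)) (fun v hv hS hRR => hC v hv hS (e hRR)) (fun v hv hS hRR => hR v hv hS (e hRR))
    (fun v hv hS hRR => hE v hv hS (e hRR)) (fun v hv hS hRR => hO v hv hS (e hRR)) (fun v hv hS hRR => hP v hv hS (e hRR))
    TE TO TP hTE hTO0 hTOs hTP0 hTP0' hTPs hv hvS (fun h => h hvc)

/-! ## §2 The same, for cones TOWARD A SUBTREE (the axis), rooted at the gate -/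

/-- **THE TREE INDUCTION LOCALISED TO ONE CONE TOWARD A SUBTREE.**  Retraction data `(h, p)` toward a vertex set `Y` (clauses (P1) (P2) (P5) (dist) of ★
`TreeRetraction.exists_retraction` as hypotheses), `c ∉ Y` with gate `y = p^[h c] c`; the tree ROOTED AT `y` (`F` finite and parent-closed toward `y`, the grandchildren
binder `GC` rooted at `y`), the local branching law assumed at the fixed self-dual vertices of the cone `Cone_Y(c) = {w | h c ≤ h w ∧ p^[h w − h c] w = c}` of `c` toward
`Y` only.  Then for every fixed self-dual `v ∈ Cone_Y(c)` the strata vector of ITS cone toward `Y` is `T(label v)` — §1 read through ★ `cone_eq_setOf_dist_root_of_mem_cone`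
(below `c` the cones toward `Y` are the rooted shadows from `y`).  In the type-(2) tube: `Y` = the axis, `c` = a collar child, `y` = its axis vertex.
[cite: Kottwitz1986, §3] [cite: Rogawski1990, §4.9 pp. 54–56] [cite: Serre1980Trees, I.2.3] -/
theorem strataVec_cone_eq_of_localLaw_of_cone_toward (hT : G.IsTree)
    {Y : Set V} {h : V → ℕ} {p : V → V}
    (h0 : ∀ v, h v = 0 ↔ v ∈ Y) (hpar : ∀ v, v ∉ Y → G.Adj v (p v) ∧ h (p v) + 1 = h v)
    (hchild : ∀ v w, v ∉ Y → G.Adj v w → w ≠ p v → h w = h v + 1 ∧ p w = v)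
    (hdist : ∀ v, (∃ y ∈ Y, G.dist v y = h v) ∧ ∀ y ∈ Y, h v ≤ G.dist v y)
    {c y : V} (hcY : c ∉ Y) (hy : p^[h c] c = y)
    (F : Set V) (hFfin : F.Finite)
    (hF : ∀ w ∈ F, w ≠ y → ∀ u, G.Adj w u → G.dist y u + 1 = G.dist y w → u ∈ F) (SD : V → Prop) (str : Fin 5 → V → Prop)
    [DecidablePred (· ∈ F)] [DecidablePred SD] [∀ j, DecidablePred (str j)]
    (hSD₁ : ∀ v c, G.Adj v c → SD v → ¬ SD c) (hSD₂ : ∀ c w, G.Adj c w → ¬ SD c → SD w)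
    (dep rk : V → ℕ) (cl : V → ℤ)
    (hstr : ∀ w ∈ F, SD w → (str 0 w ↔ dep w = 0) ∧ (str 1 w ↔ dep w = 1 ∧ rk w = 2) ∧ (str 2 w ↔ dep w = 1 ∧ rk w = 1 ∧ cl w = 1) ∧
      (str 3 w ↔ dep w = 1 ∧ rk w = 1 ∧ cl w = -1) ∧ (str 4 w ↔ 2 ≤ dep w))
    (GC : V → Set V)
    (hGC : ∀ v w, w ∈ GC v ↔ ∃ c, (G.Adj v c ∧ G.dist y c = G.dist y v + 1 ∧ c ∈ F) ∧ (G.Adj c w ∧ G.dist y w = G.dist y c + 1 ∧ w ∈ F))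
    (q : ℕ) (s : ℤ)
    (hrk : ∀ v ∈ F, SD v → v ∈ {w | h c ≤ h w ∧ p^[h w - h c] w = c} → 1 ≤ dep v → rk v = 1 ∨ rk v = 2)
    (hcl : ∀ v ∈ F, SD v → v ∈ {w | h c ≤ h w ∧ p^[h w - h c] w = c} → rk v = 1 → cl v = 1 ∨ cl v = -1)
    (hodd : ∀ v ∈ F, SD v → v ∈ {w | h c ≤ h w ∧ p^[h w - h c] w = c} → 2 ≤ dep v → rk v = 1 → Odd (dep v))
    (hB : ∀ v ∈ F, SD v → v ∈ {w | h c ≤ h w ∧ p^[h w - h c] w = c} → dep v = 0 → GC v = ∅)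
    (hC : ∀ v ∈ F, SD v → v ∈ {w | h c ≤ h w ∧ p^[h w - h c] w = c} → dep v = 1 → rk v = 1 → GC v = ∅)
    (hR : ∀ v ∈ F, SD v → v ∈ {w | h c ≤ h w ∧ p^[h w - h c] w = c} → dep v = 1 → rk v = 2 → (∀ w ∈ GC v, dep w = 0) ∧ (GC v).ncard = q)
    (hE : ∀ v ∈ F, SD v → v ∈ {w | h c ≤ h w ∧ p^[h w - h c] w = c} → ∀ m, dep v = 2 * m + 2 → rk v = 2 →
      (∀ w ∈ GC v, dep w = 2 * m + 1 ∧ rk w = 2) ∧ (GC v).ncard = q ^ 2)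
    (hO : ∀ v ∈ F, SD v → v ∈ {w | h c ≤ h w ∧ p^[h w - h c] w = c} → ∀ m, dep v = 2 * m + 3 → rk v = 2 →
      (∀ w ∈ GC v, (dep w = 2 * m + 2 ∧ rk w = 2) ∨ (dep w = 2 * m + 1 ∧ rk w = 1 ∧ (cl w = 1 ∨ cl w = -1))) ∧
        {w | w ∈ GC v ∧ dep w = 2 * m + 2}.ncard = q ∧ {w | w ∈ GC v ∧ dep w = 2 * m + 1 ∧ cl w = 1}.ncard = q.choose 2 ∧
          {w | w ∈ GC v ∧ dep w = 2 * m + 1 ∧ cl w = -1}.ncard = q.choose 2)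
    (hP : ∀ v ∈ F, SD v → v ∈ {w | h c ≤ h w ∧ p^[h w - h c] w = c} → ∀ m (c' : ℤ), dep v = 2 * m + 3 → rk v = 1 → cl v = c' →
      (∀ w ∈ GC v, dep w = 2 * m + 1 ∧ rk w = 1 ∧ cl w = s * c') ∧ (GC v).ncard = q ^ 2)
    (TE TO : ℕ → Fin 5 → ℕ) (TP : ℤ → ℕ → Fin 5 → ℕ)
    (hTE : ∀ m, TE (m + 1) = ![0, 0, 0, 0, 1] + q ^ 2 • TO m)
    (hTO0 : TO 0 = ![0, 1, 0, 0, 0] + q • ![1, 0, 0, 0, 0])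
    (hTOs : ∀ m, TO (m + 1) = ![0, 0, 0, 0, 1] + q • TE (m + 1) + q.choose 2 • (TP 1 m + TP (-1) m))
    (hTP0 : TP 1 0 = ![0, 0, 1, 0, 0]) (hTP0' : TP (-1) 0 = ![0, 0, 0, 1, 0])
    (hTPs : ∀ m (c' : ℤ), c' = 1 ∨ c' = -1 → TP c' (m + 1) = ![0, 0, 0, 0, 1] + q ^ 2 • TP (s * c') m)
    {v : V} (hv : v ∈ F) (hvS : SD v) (hvc : v ∈ {w | h c ≤ h w ∧ p^[h w - h c] w = c}) :
    (fun j => ({w | h v ≤ h w ∧ p^[h w - h v] w = v} ∩ F ∩ {w | SD w ∧ str j w}).ncard) =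
      if dep v = 0 then ![1, 0, 0, 0, 0]
      else if rk v = 2 then (if Even (dep v) then TE (dep v / 2) else TO (dep v / 2)) else TP (cl v) (dep v / 2) := by
  -- below `c`, cone toward `Y` = rooted shadow from the gate `y`
  have e : ∀ {u : V}, G.dist y u = G.dist y c + G.dist c u → u ∈ {w | h c ≤ h w ∧ p^[h w - h c] w = c} :=
    fun hu => mem_cone_of_dist_root_eq_add h0 hpar hchild hT hdist hcY hy hu
  rw [cone_eq_setOf_dist_root_of_mem_cone h0 hpar hchild hT hdist hcY hy hvc]
  exact strataVec_cone_eq_of_localLaw_of_cone hT y F hFfin hF SD str hSD₁ hSD₂ dep rk cl hstr GC hGC q s c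
    (fun v hv hS hd => hrk v hv hS (e hd)) (fun v hv hS hd => hcl v hv hS (e hd)) (fun v hv hS hd => hodd v hv hS (e hd))
    (fun v hv hS hd => hB v hv hS (e hd)) (fun v hv hS hd => hC v hv hS (e hd)) (fun v hv hS hd => hR v hv hS (e hd))
    (fun v hv hS hd => hE v hv hS (e hd)) (fun v hv hS hd => hO v hv hS (e hd)) (fun v hv hS hd => hP v hv hS (e hd))
    TE TO TP hTE hTO0 hTOs hTP0 hTP0' hTPs hv hvS (dist_root_eq_add_of_mem_cone h0 hpar hT.1 hdist hy hvc)

/-- **The fixed set is parent-closed toward the gate of a fixed vertex** (the `hF` of §2 in the application): for a `Y`-preserving automorphism `φ` with (P4) fixing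
`c`, the gate `y = p^[h c] c` is fixed (★ `apply_iterate_parent_height_eq_of_apply_eq`) and the fixed set of `φ` is parent-closed toward `y` (★ `parentClosed_fixedPoints`).
[cite: Serre1980Trees, I.6.4 Prop. 24] -/
theorem parentClosed_fixedPoints_toward_gate (hT : G.IsTree)
    {Y : Set V} {h : V → ℕ} {p : V → V}
    (h0 : ∀ v, h v = 0 ↔ v ∈ Y) (hpar : ∀ v, v ∉ Y → G.Adj v (p v) ∧ h (p v) + 1 = h v)
    (φ : G ≃g G) (hequi : ∀ v, h (φ v) = h v ∧ (v ∉ Y → p (φ v) = φ (p v)))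
    {c y : V} (hc : φ c = c) (hy : p^[h c] c = y) :
    φ y = y ∧ ∀ w ∈ {v | φ v = v}, w ≠ y → ∀ u, G.Adj w u → G.dist y u + 1 = G.dist y w → u ∈ {v | φ v = v} := by
  have hφy : φ y = y := by rw [← hy]; exact apply_iterate_parent_height_eq_of_apply_eq h0 hpar φ hequi hc
  exact ⟨hφy, parentClosed_fixedPoints hT y φ hφy⟩

end Literature.NumberTheory.Rogawski1990
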